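/-
Copyright (c) 2026 the pub-hodgecm-mathlib formalisation cell (harness21).  Prover seat hodgecm-mathlib-K2E4-p10 (g7), Track B ∕ K2-LIT, h413 = `stmt-HodgeConjecture-24833`,
line `K2_E1_TraceFormulaBeta`, 5Res ROADCARD AMENDMENT #3 G7∕G8 (KA) road (B) (dealer K2E1-plan (g7) (273)(iv)∕(277)∕(282)), item (B2): MELLIN TEST-FUNCTION DENSITY ON A VERTICAL
LINE — a continuous integrable kernel orthogonal to all Mellin transforms `f̃(−σ₀ − iy)` of smooth test functions on `(0,∞)` vanishes; two-test-function form with a bounded continuous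
kernel.  Generic (Mathlib + ★ A `K2E1MellinPaleyWienerHalfLine`).
-/
import Summits.HodgeConjecture.HodgeConjecture.Theorems.K2E1MellinPaleyWienerHalfLine   -- ★ A: `differentiable_mellin`, `verticalIntegrable_mellin`
import Mathlib.Analysis.MellinInversion
import Mathlib.Analysis.Fourier.Inversion
import Mathlib.Analysis.Distribution.AEEqOfIntegralContDiff
import Mathlib.Analysis.SpecialFunctions.Pow.Deriv
import Mathlib.Analysis.SpecialFunctions.Log.Deriv
import Mathlib.Analysis.Calculus.BumpFunction.Normed
import HarnessLib

/-!
# (KA) road (B), item (B2) — `K2E1MellinTestFunctionDensityLine`: MELLIN TEST-FUNCTION DENSITY ON A VERTICAL LINE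

Track B ∕ K2-LIT, crux h413 = `stmt-HodgeConjecture-24833`, route of record `HCCMUnconditional`; cell `hodgecm-mathlib`, squad K2, ENGINE E1; AMENDMENT #3 G7∕G8: the K-pairing
adjointness (KA) `⟨I(z)φ_a, φ_b⟩_K = ⟨φ_a, I(z̄)φ_b⟩_K` by road (B) (MW II.1.7–II.1.8: two-term formula in both orders ⇒ (B1) hermitian line identity [K2E3-p12] ⇒ (B2) density [this
file] ⇒ (B3) (KA) and continuation).  THEOREMS ONLY (no `def`, no `instance`, no `notation`, no named-fact hypothesis, no `sorry`); lane `--supports stmt-HodgeConjecture-24833 --as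
helper` (count-neutral).  Generic analysis.
THE MATHEMATICS ([Titchmarsh1948, §1.29, Thm 28]; [MoeglinWaldspurger1995, II.1.8]).  On the line `s = −σ₀ − iy` the Mellin transform of a test function is a Fourier transform:
`f̃(−σ₀ − iy) = 𝓕Φ(−y∕2π)` with `Φ(u) = e^{σ₀u} f(e^{−u})` (Mathlib `mellin_eq_fourier`), and EVERY real `Φ ∈ C^∞_c(ℝ)` arises from the admissible `f_Φ(t) = t^{σ₀}Φ(−log t)`, a smooth
function compactly supported in `(0,∞)` (§1).  Hence if a continuous integrable kernel `k` satisfies `∫ f̃(−σ₀−iy)·k(y) dy = 0` for all admissible `f`, then `∫ 𝓕Φ·K = 0` for all real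
`Φ ∈ C^∞_c(ℝ)` (`K(w) = k(−2πw)`), so `∫ Φ·𝓕K = 0` (self-adjointness of `𝓕`), so `𝓕K = 0` a.e. (fundamental lemma of the calculus of variations, Mathlib
`ae_eq_zero_of_integral_contDiff_smul_eq_zero`), hence everywhere (continuity), hence `K = 𝓕⁻𝓕K = 0` (Fourier inversion): **`k ≡ 0`** (§2).  With TWO test functions — the shape delivered by
the hermitian line identity (B1), `∫ f̃(−z)·conj g̃(−z̄)·h = 0` (`z = σ₀ + iy`) — a bounded continuous `h` vanishes: fix the bump `g`; `k = conj g̃(−z̄)·h` is continuous and integrable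
(★ A: `g̃` is rapidly decreasing on vertical lines), so `k ≡ 0`; where `h(y₀) ≠ 0` the entire function `g̃` (★ A `differentiable_mellin`) vanishes on a segment of the line, hence
identically — contradicting `g̃(1) = ∫ g > 0` (§3).
* §1 (THIS EDITION) `contDiff_rpowTest`, `rpowTest_eq_zero_of_notMem`, `hasCompactSupport_rpowTest`, `tsupport_rpowTest_subset`, `exp_smul_rpowTest_exp_neg` — the admissible test
  function `f_Φ` and its Mellin–Fourier dictionary (the only non-Mathlib ingredient of the density argument).
* §2∕§3 (ED. 2, append-only, same file): HEADS `eq_zero_of_forall_integral_mellin_mul_eq_zero` (kernel form) and `eq_zero_of_forall_integral_mellin_mul_conj_mellin_mul_eq_zero` (the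
  two-test-function form consumed by (B3)) — road: Mathlib `mellin_eq_fourier` + §1, `y = −2πw` (`Measure.integral_comp_mul_left`), `VectorFourier.integral_fourierIntegral_smul_eq_flip`,
  `ae_eq_zero_of_integral_contDiff_smul_eq_zero`, `Continuous.ae_eq_iff_eq`, `Continuous.fourierInv_fourier_eq`; §3 adds ★ A `verticalIntegrable_mellin`∕`differentiable_mellin`, a
  `ContDiffBump (1 : ℝ)` test function and `AnalyticOnNhd.eqOn_zero_of_preconnected_of_frequently_eq_zero`.
HONEST LABEL: HC_CM is proved only modulo the 7 printed citations (2 remaining named inputs: hLiu418 = `stmt-HodgeConjecture-24832`, h413 = `stmt-HodgeConjecture-24833`) until rung 0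
closes; this file asserts no named fact and closes no socket; count-neutral; generic Mellin∕Fourier analysis.

## References
* [Titchmarsh1948] E. C. Titchmarsh, *Introduction to the Theory of Fourier Integrals* (2nd ed., 1948), §1.29, Thm 28 (Mellin inversion ∕ uniqueness).
* [MoeglinWaldspurger1995] C. Mœglin, J.-L. Waldspurger, *Spectral decomposition and Eisenstein series* (1995), II.1.8.
-/

set_option autoImplicit false
set_option linter.dupNamespace false  -- the mandated namespace repeats the summit's segment (`HodgeConjecture.HodgeConjecture`)

noncomputable section

open MeasureTheory Set Filter Topology Complex Real
open scoped ComplexConjugate FourierTransform ContDiff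
open Summit.HodgeConjecture.HodgeConjecture.Cruxes.H413.K2E1MellinPaleyWienerHalfLine (differentiable_mellin verticalIntegrable_mellin)

namespace Summit.HodgeConjecture.HodgeConjecture.Cruxes.H413.K2E1MellinTestFunctionDensityLine

/-! ## §1 The admissible test function `f_Φ(t) = t^{σ₀}·Φ(−log t)` (`t > 0`), `0` (`t ≤ 0`) -/

/-- `f_Φ` is smooth when `Φ ∈ C^∞_c(ℝ)`: on `(0,∞)` it is `t^{σ₀}·Φ(−log t)`, and it vanishes identically on `(−∞, e^{−R})` if `tsupport Φ ⊆ [−R, R]`. [folklore] -/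
theorem contDiff_rpowTest (σ₀ : ℝ) {Φ : ℝ → ℝ} (hΦ : ContDiff ℝ ∞ Φ) {R : ℝ} (hR : tsupport Φ ⊆ Icc (-R) R) :
    ContDiff ℝ ∞ (fun t : ℝ => if 0 < t then t ^ σ₀ * Φ (-Real.log t) else 0) := by
  refine contDiff_iff_contDiffAt.2 fun t => ?_
  by_cases ht : Real.exp (-R) / 2 < t
  · -- on a neighbourhood of `t > 0` the function is the smooth expression
    have ht0 : 0 < t := lt_trans (by positivity) ht
    have hsm : ContDiffAt ℝ ∞ (fun t : ℝ => t ^ σ₀ * Φ (-Real.log t)) t :=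
      (Real.contDiffAt_rpow_const_of_ne ht0.ne').mul (hΦ.contDiffAt.comp t (Real.contDiffAt_log.2 ht0.ne').neg)
    refine hsm.congr_of_eventuallyEq ?_
    filter_upwards [Ioi_mem_nhds ht0] with t' ht'
    rw [if_pos (show 0 < t' from ht')]
  · -- on `(−∞, e^{−R})` the function vanishes identically
    have ht' : t < Real.exp (-R) := lt_of_le_of_lt (not_lt.1 ht) (by linarith [Real.exp_pos (-R)])
    refine (contDiffAt_const (c := (0 : ℝ))).congr_of_eventuallyEq ?_
    filter_upwards [Iio_mem_nhds ht'] with t' ht'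
    replace ht' : t' < Real.exp (-R) := ht'
    split_ifs with h0
    · have hlog : R < -Real.log t' := by
        have := Real.log_lt_log h0 ht'
        rw [Real.log_exp] at this
        linarith
      have hΦ0 : Φ (-Real.log t') = 0 := by
        refine image_eq_zero_of_notMem_tsupport fun hmem => ?_
        exact absurd (hR hmem).2 (not_le.2 hlog)
      rw [hΦ0, mul_zero]
    · rfl

/-- `f_Φ` is supported in `[e^{−R}, e^{R}]` when `tsupport Φ ⊆ [−R, R]`. [folklore] -/
theorem rpowTest_eq_zero_of_notMem (σ₀ : ℝ) {Φ : ℝ → ℝ} {R : ℝ} (hR : tsupport Φ ⊆ Icc (-R) R) {t : ℝ} (ht : t ∉ Icc (Real.exp (-R)) (Real.exp R)) :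
    (if 0 < t then t ^ σ₀ * Φ (-Real.log t) else 0) = 0 := by
  split_ifs with h0
  · have hΦ0 : Φ (-Real.log t) = 0 := by
      refine image_eq_zero_of_notMem_tsupport fun hmem => ht ?_
      have h1 := (hR hmem).1
      have h2 := (hR hmem).2
      constructor
      · calc Real.exp (-R) ≤ Real.exp (Real.log t) := Real.exp_le_exp.2 (by linarith)
          _ = t := Real.exp_log h0
      · calc t = Real.exp (Real.log t) := (Real.exp_log h0).symm
          _ ≤ Real.exp R := Real.exp_le_exp.2 (by linarith)
    rw [hΦ0, mul_zero]
  · rfl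

/-- `f_Φ` has compact support. [folklore] -/
theorem hasCompactSupport_rpowTest (σ₀ : ℝ) {Φ : ℝ → ℝ} {R : ℝ} (hR : tsupport Φ ⊆ Icc (-R) R) :
    HasCompactSupport (fun t : ℝ => if 0 < t then t ^ σ₀ * Φ (-Real.log t) else 0) :=
  HasCompactSupport.intro isCompact_Icc fun _ ht => rpowTest_eq_zero_of_notMem σ₀ hR ht

/-- `tsupport f_Φ ⊆ (0, ∞)`. [folklore] -/
theorem tsupport_rpowTest_subset (σ₀ : ℝ) {Φ : ℝ → ℝ} {R : ℝ} (hR : tsupport Φ ⊆ Icc (-R) R) :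
    tsupport (fun t : ℝ => if 0 < t then t ^ σ₀ * Φ (-Real.log t) else 0) ⊆ Ioi 0 := by
  have h1 : Function.support (fun t : ℝ => if 0 < t then t ^ σ₀ * Φ (-Real.log t) else 0) ⊆ Icc (Real.exp (-R)) (Real.exp R) :=
    fun t ht => by_contra fun h => ht (rpowTest_eq_zero_of_notMem σ₀ hR h)
  have h2 : tsupport (fun t : ℝ => if 0 < t then t ^ σ₀ * Φ (-Real.log t) else 0) ⊆ Icc (Real.exp (-R)) (Real.exp R) := closure_minimal h1 isClosed_Icc
  exact h2.trans fun t ht => lt_of_lt_of_le (Real.exp_pos (-R)) ht.1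

/-- **The Mellin–Fourier dictionary for `f_Φ`**: `e^{σ₀u} • f_Φ(e^{−u}) = Φ(u)` (as complex numbers; the integrand of Mathlib `mellin_eq_fourier` at `Re s = −σ₀`).
[cite: Titchmarsh1948, §1.29] -/
theorem exp_smul_rpowTest_exp_neg (σ₀ : ℝ) (Φ : ℝ → ℝ) (u : ℝ) :
    Real.exp (-(-σ₀) * u) • Complex.ofReal (if 0 < Real.exp (-u) then Real.exp (-u) ^ σ₀ * Φ (-Real.log (Real.exp (-u))) else 0) = Complex.ofReal (Φ u) := by
  rw [if_pos (Real.exp_pos _), Real.log_exp, Real.rpow_def_of_pos (Real.exp_pos _), Real.log_exp, Complex.real_smul, ← Complex.ofReal_mul]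
  congr 1
  rw [← mul_assoc, ← Real.exp_add, neg_neg, neg_neg, show σ₀ * u + -u * σ₀ = 0 by ring, Real.exp_zero, one_mul]


/-! ## §2 Mellin test-function density on the line `Re s = −σ₀` (kernel form)

ED. 2 (seat K2E4-p10 (g8), append-only).  Three casting trivialities, the Mellin–Fourier dictionary on the line, and the kernel density theorem. -/

open Summit.HodgeConjecture.HodgeConjecture.Cruxes.H413.K2E1MellinPaleyWienerHalfLine (mellin_eq_integral norm_mellin_vertical_le)

/-- The complexification `t ↦ (f t : ℂ)` of a real function has the same topological support. [folklore] -/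
theorem tsupport_ofReal_comp (f : ℝ → ℝ) : tsupport (fun t => (f t : ℂ)) = tsupport f :=
  tsupport_comp_eq (g := Complex.ofReal) Complex.ofReal_eq_zero f

/-- The complexification of a compactly supported real function is compactly supported. [folklore] -/
theorem hasCompactSupport_ofReal_comp {f : ℝ → ℝ} (hf : HasCompactSupport f) : HasCompactSupport (fun t => (f t : ℂ)) :=
  hf.comp_left Complex.ofReal_zero

/-- The complexification of a `Cⁿ` real function is `Cⁿ`. [folklore] -/
theorem contDiff_ofReal_comp {f : ℝ → ℝ} {n : WithTop ℕ∞} (hf : ContDiff ℝ n f) : ContDiff ℝ n (fun t => (f t : ℂ)) :=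
  Complex.ofRealCLM.contDiff.comp hf

/-- **The Mellin–Fourier dictionary on the line `Re s = −σ₀`.**  For real `Φ` and the admissible test function `f_Φ(t) = t^{σ₀}Φ(−log t)` (§1):
`mellin f_Φℂ (−σ₀ − iy) = 𝓕 Φℂ (−y ∕ 2π)` (Mathlib `mellin_eq_fourier` + §1 `exp_smul_rpowTest_exp_neg`). [cite: Titchmarsh1948, §1.29] -/
theorem mellin_rpowTest_eq_fourier (σ₀ : ℝ) (Φ : ℝ → ℝ) (y : ℝ) :
    mellin (fun t : ℝ => ((if 0 < t then t ^ σ₀ * Φ (-Real.log t) else 0 : ℝ) : ℂ)) (-((σ₀ : ℂ) + y * I)) = 𝓕 (fun u : ℝ => (Φ u : ℂ)) (-y / (2 * π)) := by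
  rw [mellin_eq_fourier]
  have hre : (-((σ₀ : ℂ) + y * I)).re = -σ₀ := by simp
  have him : (-((σ₀ : ℂ) + y * I)).im = -y := by simp
  rw [hre, him]
  exact congrArg (fun F : ℝ → ℂ => 𝓕 F (-y / (2 * π))) (funext fun u => exp_smul_rpowTest_exp_neg σ₀ Φ u)

/-- **§2 KERNEL DENSITY (Mellin test-function density on a vertical line).**  Let `k : ℝ → ℂ` be continuous and integrable.  If
`∫_ℝ f̃(−σ₀ − iy)·k(y) dy = 0` for every REAL test function `f ∈ C^∞_c((0,∞))` (`f̃ = mellin fℂ`), then `k ≡ 0`.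
Proof: by §1 every real `Φ ∈ C^∞_c(ℝ)` is `u ↦ e^{σ₀u} f_Φ(e^{−u})`, so (`mellin_rpowTest_eq_fourier`, `y = −2πw`) `∫ 𝓕Φℂ·K = 0` with `K(w) = k(−2πw)`; self-adjointness of `𝓕`
(`VectorFourier.integral_fourierIntegral_smul_eq_flip`) gives `∫ Φ·𝓕K = 0` for all real `Φ ∈ C^∞_c`, so `𝓕K = 0` a.e. (`ae_eq_zero_of_integral_contDiff_smul_eq_zero`), hence everywhere
(continuity), hence `K = 𝓕⁻𝓕K = 0` (`Continuous.fourierInv_fourier_eq`). [cite: Titchmarsh1948, §1.29] -/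
theorem eq_zero_of_forall_integral_mellin_mul_eq_zero (σ₀ : ℝ) {k : ℝ → ℂ} (hk : Continuous k) (hki : Integrable k)
    (h : ∀ Φf : ℝ → ℝ, ContDiff ℝ ∞ Φf → HasCompactSupport Φf → tsupport Φf ⊆ Ioi 0 →
      ∫ y : ℝ, mellin (fun t => (Φf t : ℂ)) (-((σ₀ : ℂ) + y * I)) * k y = 0) :
    k = 0 := by
  have hπ : (2 * π : ℝ) ≠ 0 := by positivity
  have hπ' : (-(2 * π) : ℝ) ≠ 0 := neg_ne_zero.2 hπ
  -- the rescaled kernel `K(w) = k(−2πw)`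
  set K : ℝ → ℂ := fun w => k (-(2 * π * w)) with hK
  have hKc : Continuous K := hk.comp (by fun_prop)
  have hKi : Integrable K := by
    refine (hki.comp_mul_left' hπ').congr (ae_of_all _ fun w => ?_)
    simp only [hK, neg_mul]
  -- Step 1: `∫ 𝓕Φℂ · K = 0` for every real `Φ ∈ C^∞_c(ℝ)`
  have h1 : ∀ Φ : ℝ → ℝ, ContDiff ℝ ∞ Φ → HasCompactSupport Φ → ∫ w : ℝ, 𝓕 (fun u : ℝ => (Φ u : ℂ)) w * K w = 0 := by
    intro Φ hΦ hΦs
    obtain ⟨R, hR⟩ := hΦs.isCompact.isBounded.subset_closedBall 0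
    rw [Real.closedBall_eq_Icc, zero_sub, zero_add] at hR
    have h0 : ∫ y : ℝ, 𝓕 (fun u : ℝ => (Φ u : ℂ)) (-y / (2 * π)) * k y = 0 := by
      refine Eq.trans (integral_congr_ae (ae_of_all _ fun y => ?_))
        (h _ (contDiff_rpowTest σ₀ hΦ hR) (hasCompactSupport_rpowTest σ₀ hR) (tsupport_rpowTest_subset σ₀ hR))
      simp only [mellin_rpowTest_eq_fourier]
    have hsub := Measure.integral_comp_mul_left (fun y : ℝ => 𝓕 (fun u : ℝ => (Φ u : ℂ)) (-y / (2 * π)) * k y) (-(2 * π))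
    rw [h0, smul_zero] at hsub
    refine Eq.trans (integral_congr_ae (ae_of_all _ fun w => ?_)) hsub
    simp only [hK, neg_mul, neg_neg, mul_div_cancel_left₀ w hπ]
  -- Step 2: self-adjointness of `𝓕` ⇒ `∫ Φℂ · 𝓕K = 0`
  have h2 : ∀ Φ : ℝ → ℝ, ContDiff ℝ ∞ Φ → HasCompactSupport Φ → ∫ x : ℝ, (Φ x : ℂ) * 𝓕 K x = 0 := by
    intro Φ hΦ hΦs
    have hΦi : Integrable (fun u : ℝ => (Φ u : ℂ)) := (hΦ.continuous.integrable_of_hasCompactSupport hΦs).ofReal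
    have hflip : ∫ ξ : ℝ, 𝓕 (fun u : ℝ => (Φ u : ℂ)) ξ • K ξ = ∫ x : ℝ, (Φ x : ℂ) • 𝓕 K x := by
      have := VectorFourier.integral_fourierIntegral_smul_eq_flip (L := innerₗ ℝ) (μ := volume) (ν := volume)
        Real.continuous_fourierChar continuous_inner hΦi hKi
      rw [flip_innerₗ] at this
      exact this
    simp only [smul_eq_mul] at hflip
    rw [← hflip]
    exact h1 Φ hΦ hΦs
  -- Step 3: `𝓕K` is continuous and vanishes a.e., hence everywhere
  have hFKc : Continuous (𝓕 K) := VectorFourier.fourierIntegral_continuous Real.continuous_fourierChar continuous_inner hKi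
  have hFK0 : 𝓕 K = 0 := by
    have hae : ∀ᵐ x : ℝ, 𝓕 K x = 0 :=
      ae_eq_zero_of_integral_contDiff_smul_eq_zero hFKc.locallyIntegrable fun Φ hΦ hΦs => by
        simp only [Complex.real_smul]
        exact h2 Φ hΦ hΦs
    exact (hFKc.ae_eq_iff_eq volume continuous_zero).1 hae
  -- Step 4: Fourier inversion ⇒ `K = 0`
  have hK0 : K = 0 := by
    have hinv := hKc.fourierInv_fourier_eq hKi (by rw [hFK0]; exact integrable_zero _ _ _)
    rw [← hinv, hFK0]
    funext w
    simp only [Real.fourierInv_eq, Pi.zero_apply, smul_zero, integral_zero]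
  -- Step 5: undo the rescaling
  funext y
  have := congrFun hK0 (-(y / (2 * π)))
  simp only [hK, Pi.zero_apply] at this
  rwa [show -(2 * π * -(y / (2 * π))) = y by rw [mul_neg, neg_neg, mul_div_cancel₀ y hπ]] at this

/-! ## §3 The two-test-function form (bounded continuous kernel) — the shape delivered by the hermitian line identity (B1) -/

/-- **§3 TWO-TEST-FUNCTION DENSITY.**  Let `h : ℝ → ℂ` be continuous and bounded.  If for all REAL `f, g ∈ C^∞_c((0,∞))`
`∫_ℝ f̃(−z)·conj g̃(−z̄)·h(t) dt = 0` (`z = σ₀ + it`; the integrand of (B1)), then `h ≡ 0`.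
Proof: fix the bump `g` (`ContDiffBump (1 : ℝ)`, supported in `[1∕2, 3∕2]`); `k = conj g̃(−z̄)·h` is continuous (★ A `differentiable_mellin`) and integrable (★ A `verticalIntegrable_mellin` at `−σ₀`, `h`
bounded), so `k ≡ 0` by §2; where `h(t₀) ≠ 0` the entire function `g̃` vanishes at the points `−σ₀ + it`, `t` near `t₀`, which accumulate at `−σ₀ + it₀`, so `g̃ ≡ 0`
(`AnalyticOnNhd.eqOn_zero_of_preconnected_of_frequently_eq_zero`) — contradicting `g̃(1) = ∫ g > 0`. [cite: Titchmarsh1948, §1.29] [cite: MoeglinWaldspurger1995, II.1.8] -/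
theorem eq_zero_of_forall_integral_mellin_mul_conj_mellin_mul_eq_zero (σ₀ : ℝ) {h : ℝ → ℂ} (hh : Continuous h) {C : ℝ} (hC : ∀ y, ‖h y‖ ≤ C)
    (H : ∀ f g : ℝ → ℝ, ContDiff ℝ ∞ f → HasCompactSupport f → tsupport f ⊆ Ioi 0 → ContDiff ℝ ∞ g → HasCompactSupport g → tsupport g ⊆ Ioi 0 →
      ∫ y : ℝ, mellin (fun t => (f t : ℂ)) (-((σ₀ : ℂ) + y * I)) * conj (mellin (fun t => (g t : ℂ)) (-conj ((σ₀ : ℂ) + y * I))) * h y = 0) :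
    h = 0 := by
  -- the fixed second test function: a smooth bump around `1`, supported in `[1/2, 3/2] ⊆ (0,∞)`
  let b : ContDiffBump (1 : ℝ) := ⟨1 / 4, 1 / 2, by norm_num, by norm_num⟩
  have hrOut : b.rOut = 1 / 2 := rfl
  have hb : ContDiff ℝ ∞ (b : ℝ → ℝ) := b.contDiff
  have hbs : HasCompactSupport (b : ℝ → ℝ) := b.hasCompactSupport
  have hb0 : tsupport (b : ℝ → ℝ) ⊆ Ioi 0 := by
    rw [b.tsupport_eq, hrOut, Real.closedBall_eq_Icc]
    intro t ht
    exact lt_of_lt_of_le (by norm_num) ht.1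
  -- its complexification
  have hgc : Continuous fun t : ℝ => ((b t : ℝ) : ℂ) := continuous_ofReal.comp b.continuous
  have hgs : HasCompactSupport fun t : ℝ => ((b t : ℝ) : ℂ) := hasCompactSupport_ofReal_comp hbs
  have hg0 : tsupport (fun t : ℝ => ((b t : ℝ) : ℂ)) ⊆ Ioi 0 := by rw [tsupport_ofReal_comp]; exact hb0
  have hg2 : ContDiff ℝ 2 fun t : ℝ => ((b t : ℝ) : ℂ) := contDiff_ofReal_comp b.contDiff
  -- the line `t ↦ −conj(σ₀ + it) = −σ₀ + it`
  have hline : ∀ t : ℝ, -conj ((σ₀ : ℂ) + t * I) = ((-σ₀ : ℝ) : ℂ) + t * I := fun t => by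
    apply Complex.ext <;> simp
  -- the kernel `k = conj g̃(−σ₀ + it) · h`
  set k : ℝ → ℂ := fun t => conj (mellin (fun t : ℝ => ((b t : ℝ) : ℂ)) (-conj ((σ₀ : ℂ) + t * I))) * h t with hk
  have hmc : Continuous fun t : ℝ => mellin (fun t : ℝ => ((b t : ℝ) : ℂ)) (-conj ((σ₀ : ℂ) + t * I)) := by
    simp_rw [hline]
    exact (differentiable_mellin hgc hgs hg0).continuous.comp (by fun_prop)
  have hkc : Continuous k := (Complex.continuous_conj.comp hmc).mul hh
  have hki : Integrable k := by
    have hv : Integrable fun y : ℝ => mellin (fun t : ℝ => ((b t : ℝ) : ℂ)) (((-σ₀ : ℝ) : ℂ) + y * I) := verticalIntegrable_mellin hg2 hgs hg0 (-σ₀)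
    refine (hv.norm.mul_const C).mono' hkc.aestronglyMeasurable (ae_of_all _ fun t => ?_)
    simp only [hk]
    rw [norm_mul, Complex.norm_conj, hline]
    exact mul_le_mul_of_nonneg_left (hC t) (norm_nonneg _)
  -- §2 ⇒ `k ≡ 0`
  have hk0 : k = 0 := eq_zero_of_forall_integral_mellin_mul_eq_zero σ₀ hkc hki fun f hf hfs hf0 => by
    have := H f b hf hfs hf0 hb hbs hb0
    simpa only [hk, mul_assoc] using this
  -- suppose `h t₀ ≠ 0`
  by_contra hne
  obtain ⟨t₀, ht₀⟩ : ∃ t₀ : ℝ, h t₀ ≠ 0 := by simpa [funext_iff] using hne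
  -- then `g̃ℂ(−σ₀ + it) = 0` for `t` near `t₀`
  have hev : ∀ᶠ t : ℝ in 𝓝 t₀, mellin (fun t : ℝ => ((b t : ℝ) : ℂ)) (((-σ₀ : ℝ) : ℂ) + (t : ℂ) * I) = 0 := by
    filter_upwards [hh.continuousAt.eventually_ne ht₀] with t ht
    have h0 := congrFun hk0 t
    simp only [hk, Pi.zero_apply, mul_eq_zero, map_eq_zero] at h0
    rw [hline] at h0
    exact h0.resolve_right ht
  -- the points `−σ₀ + it` accumulate at `−σ₀ + it₀`
  have hL : Tendsto (fun t : ℝ => ((-σ₀ : ℝ) : ℂ) + t * I) (𝓝[≠] t₀) (𝓝[≠] (((-σ₀ : ℝ) : ℂ) + t₀ * I)) := by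
    refine tendsto_nhdsWithin_of_tendsto_nhds_of_eventually_within _
      (((by fun_prop : Continuous fun t : ℝ => ((-σ₀ : ℝ) : ℂ) + t * I).tendsto t₀).mono_left nhdsWithin_le_nhds)
      (eventually_nhdsWithin_of_forall fun t ht heq => ht ?_)
    simpa using congrArg Complex.im (Set.mem_singleton_iff.1 heq)
  have hfreq : ∃ᶠ z in 𝓝[≠] (((-σ₀ : ℝ) : ℂ) + t₀ * I), mellin (fun t : ℝ => ((b t : ℝ) : ℂ)) z = 0 :=
    hL.frequently (hev.filter_mono nhdsWithin_le_nhds).frequently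
  -- identity theorem: `g̃ℂ ≡ 0`
  have han : AnalyticOnNhd ℂ (mellin fun t : ℝ => ((b t : ℝ) : ℂ)) univ :=
    analyticOnNhd_univ_iff_differentiable.2 (differentiable_mellin hgc hgs hg0)
  have hzero := han.eqOn_zero_of_preconnected_of_frequently_eq_zero isPreconnected_univ (mem_univ _) hfreq (mem_univ (1 : ℂ))
  -- but `g̃ℂ(1) = ∫ g > 0`
  have h1 : mellin (fun t : ℝ => ((b t : ℝ) : ℂ)) 1 = ((∫ t : ℝ, b t : ℝ) : ℂ) := by
    rw [mellin_eq_integral hg0, sub_self]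
    simp_rw [cpow_zero, one_mul]
    exact integral_complex_ofReal
  rw [h1, Pi.zero_apply, Complex.ofReal_eq_zero] at hzero
  exact (b.integral_pos (μ := volume)).ne' hzero

/-- **§3, CONSUMER FORM (equality of integrals, complex `C²` test functions — exactly the shape of the hermitian line identity (B1)).**  Let `h₁, h₂ : ℝ → ℂ` be
continuous and bounded.  If for all COMPLEX `f, g ∈ C²_c((0,∞))` `∫_ℝ f̃(−z)·conj g̃(−z̄)·h₁ dt = ∫_ℝ f̃(−z)·conj g̃(−z̄)·h₂ dt` (`z = σ₀ + it`), then `h₁ = h₂`.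
(The common factor `f̃(−z)·conj g̃(−z̄)` is integrable — ★ A `verticalIntegrable_mellin`, `norm_mellin_vertical_le` — so the two integrals may be subtracted; then §3.)
[cite: MoeglinWaldspurger1995, II.1.8] -/
theorem eq_of_forall_integral_mellin_mul_conj_mellin_mul_eq (σ₀ : ℝ) {h₁ h₂ : ℝ → ℂ} (hh₁ : Continuous h₁) (hh₂ : Continuous h₂) {C₁ C₂ : ℝ}
    (hC₁ : ∀ y, ‖h₁ y‖ ≤ C₁) (hC₂ : ∀ y, ‖h₂ y‖ ≤ C₂)
    (H : ∀ f g : ℝ → ℂ, ContDiff ℝ 2 f → HasCompactSupport f → tsupport f ⊆ Ioi 0 → ContDiff ℝ 2 g → HasCompactSupport g → tsupport g ⊆ Ioi 0 →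
      ∫ y : ℝ, mellin f (-((σ₀ : ℂ) + y * I)) * conj (mellin g (-conj ((σ₀ : ℂ) + y * I))) * h₁ y =
        ∫ y : ℝ, mellin f (-((σ₀ : ℂ) + y * I)) * conj (mellin g (-conj ((σ₀ : ℂ) + y * I))) * h₂ y) :
    h₁ = h₂ := by
  have hline : ∀ t : ℝ, -conj ((σ₀ : ℂ) + t * I) = ((-σ₀ : ℝ) : ℂ) + t * I := fun t => by
    apply Complex.ext <;> simp
  have hneg : ∀ t : ℝ, -((σ₀ : ℂ) + t * I) = ((-σ₀ : ℝ) : ℂ) + ((-t : ℝ) : ℂ) * I := fun t => by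
    apply Complex.ext <;> simp
  refine sub_eq_zero.1 (eq_zero_of_forall_integral_mellin_mul_conj_mellin_mul_eq_zero σ₀ (hh₁.sub hh₂) (C := C₁ + C₂)
    (fun y => (norm_sub_le _ _).trans (add_le_add (hC₁ y) (hC₂ y))) fun f g hf hfs hf0 hg hgs hg0 => ?_)
  -- complexified data
  have hfc : ContDiff ℝ 2 fun t : ℝ => (f t : ℂ) := contDiff_ofReal_comp (hf.of_le (WithTop.coe_le_coe.2 le_top))
  have hfs' : HasCompactSupport fun t : ℝ => (f t : ℂ) := hasCompactSupport_ofReal_comp hfs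
  have hf0' : tsupport (fun t : ℝ => (f t : ℂ)) ⊆ Ioi 0 := by rw [tsupport_ofReal_comp]; exact hf0
  have hgc : ContDiff ℝ 2 fun t : ℝ => (g t : ℂ) := contDiff_ofReal_comp (hg.of_le (WithTop.coe_le_coe.2 le_top))
  have hgs' : HasCompactSupport fun t : ℝ => (g t : ℂ) := hasCompactSupport_ofReal_comp hgs
  have hg0' : tsupport (fun t : ℝ => (g t : ℂ)) ⊆ Ioi 0 := by rw [tsupport_ofReal_comp]; exact hg0
  -- the common factor `F(t) = f̃(−z)·conj g̃(−z̄)` is integrable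
  have hF : Integrable fun y : ℝ => mellin (fun t : ℝ => (f t : ℂ)) (-((σ₀ : ℂ) + y * I)) * conj (mellin (fun t : ℝ => (g t : ℂ)) (-conj ((σ₀ : ℂ) + y * I))) := by
    have hv : Integrable fun y : ℝ => mellin (fun t : ℝ => (f t : ℂ)) (((-σ₀ : ℝ) : ℂ) + y * I) := verticalIntegrable_mellin hfc hfs' hf0' (-σ₀)
    have hv' : Integrable fun y : ℝ => mellin (fun t : ℝ => (f t : ℂ)) (-((σ₀ : ℂ) + y * I)) := by
      refine hv.comp_neg.congr (ae_of_all _ fun y => ?_)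
      simp only [hneg]
    have hmc : Continuous fun y : ℝ => conj (mellin (fun t : ℝ => (g t : ℂ)) (-conj ((σ₀ : ℂ) + y * I))) := by
      simp_rw [hline]
      exact Complex.continuous_conj.comp ((differentiable_mellin hgc.continuous hgs' hg0').continuous.comp (by fun_prop))
    refine hv'.mul_bdd (c := ∫ t in Ioi 0, t ^ (-σ₀ - 1) * ‖((g t : ℝ) : ℂ)‖) hmc.aestronglyMeasurable (ae_of_all _ fun y => ?_)
    rw [Complex.norm_conj, hline]
    exact norm_mellin_vertical_le _ (-σ₀) y
  have e := H _ _ hfc hfs' hf0' hgc hgs' hg0'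
  simp only [Pi.sub_apply, mul_sub]
  rw [integral_sub (hF.mul_bdd hh₁.aestronglyMeasurable (ae_of_all _ hC₁)) (hF.mul_bdd hh₂.aestronglyMeasurable (ae_of_all _ hC₂)), e, sub_self]

end Summit.HodgeConjecture.HodgeConjecture.Cruxes.H413.K2E1MellinTestFunctionDensityLine

end
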